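import Literature.Analysis.FluidPDE.RusinSverakWeakStabilitySixLeaves
import Literature.Analysis.FluidPDE.RusinSverakWeakStabilityProofs
import Literature.Analysis.FluidPDE.KatoFarFieldBound
import HarnessLib

/-!
# Rusin–Šverák, Cor. 4.3, over the six remaining leaves of its cone

Analysis/FluidPDE proof file (no definitions, no named facts) for the named fact
`Literature.Analysis.FluidPDE.rusin_sverak_minimal_data_compact` (`RusinSverakCompactness.lean`;
W. Rusin, V. Šverák, *Minimal initial data for potential Navier–Stokes singularities*,
J. Funct. Anal. 260 (2011) 879–891 = arXiv:0911.0500, **Cor. 4.3** p. 8, second clause: the set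
`M` of `Ḣ^{1/2}`-minimal blow-up data is compact modulo scalings and translations; first clause
`rusin_sverak_minimal_blowup`, `MildSolutions.lean`; sentences 2–4 of the printed proof
`rusin_sverak_weak_limit_blowup`, `RusinSverakCompactnessProofs.lean`).

The accepted reduction `rusin_sverak_minimal_data_compact_of_singular_points'`
(`RusinSverakWeakStabilityProofs.lean`) derives Cor. 4.3 from the two PDE statements of the
printed proof: **N** `rusin_sverak_singular_point_of_blowup` (§4 p. 6, "the only reason for
`T_max(u₀) < ∞` is a singularity at `t = T_max`") and **C**
`rusin_sverak_weak_limit_of_singular_points` (Cor. 4.2 at the level of data). The tree has now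
DISCHARGED **N** (`rusin_sverak_singular_point_of_blowup_holds`, `KatoFarFieldBound.lean`:
the far-field bound of Kato solutions near the blow-up time, `IsKatoSolutionOn.farField_bound_holds`,
with Kato's local theory, its `L^∞` continuation and ε-regularity), and has reduced **C** to
exactly six named facts of the local Leray theory
(`rusin_sverak_weak_limit_of_singular_points_of_six_leaves`, `RusinSverakWeakStabilitySixLeaves.lean`),
each a published theorem with its own locator, quoted in its file:

1. `localEnergySolution_exists_local_of_memE2` — local-in-time local energy solutions for `E²`
   data (Lemarié-Rieusset 2016 Thm. 14.1; Seregin 2014 Prop. 1.8), `LocalEnergyExtension.lean`;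
2. `localEnergySolution_extension_of_memE2` — the extension step (Seregin 2014 App. B §B.5;
   Lemarié-Rieusset 2016 Thm. 14.8, proof, Steps 1–3), `LocalEnergyExtension.lean`;
3. `local_leray_difference_energy_estimate` — the local energy estimate for the difference of
   two local Leray solutions (Lemarié-Rieusset 2016 Thm. 14.7, proof, pp. 515–518),
   `LocalLerayWeakStrongProofs.lean`;
4. `jia_sverak_2013_lemma_2` — the a-priori local energy estimate for local Leray solutions
   (Jia–Šverák 2013 Lemma 2 with (2.9)), `JiaSverak2013AprioriEstimate.lean`;
5. `jia_sverak_2013_lemma_8` — the uniform initial layer (Jia–Šverák 2013 Lemma 8;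
   Lemarié-Rieusset 2016 Prop. 15.1), `JiaSverak2013Compactness.lean`;
6. `localLeray_limit_isLocalLeraySolution` — the limit of local Leray solutions is a local Leray
   solution with the weak-limit datum (Jia–Šverák 2013, proof of Thm. 1, p. 8; Lemarié-Rieusset
   2016, proof of Thm. 15.5), `LocalLerayLimitingProcedure.lean`.

Compared with `rusin_sverak_minimal_data_compact_of_seven_leaves`
(`RusinSverakCompactnessSevenLeaves.lean`), the local pressure decomposition
(`kangMiuraTsai_pressure_decomposition`) is no longer an input: it entered only through the
far-field bound **F** of Leray solutions, which the discharge of **N** along the Kato-side route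
bypasses. This file composes the two reductions with the discharge of **N** and records Cor. 4.3
(both clauses) and the weak-limit blow-up as consequences of the six leaves; it also merges the
import closure of the Kato-side discharge (`KatoFarFieldBound.lean`) with that of the local Leray
cone, so that `rusin_sverak_minimal_data_compact_holds` is the one-line file
`rusin_sverak_minimal_data_compact_of_six_leaves h₁_holds … h₆_holds` over this one once the six
`_holds` theorems exist.

## References

* W. Rusin, V. Šverák, J. Funct. Anal. 260 (2011) 879–891 = arXiv:0911.0500, Cor. 4.3 and its
  proof (p. 8), §4 p. 6, Thm. 4.1, Thm. 4.2, Cor. 4.2, Prop. 2.2, Lemma 2.1. [RusinSverak2011]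
* P. G. Lemarié-Rieusset, *The Navier–Stokes Problem in the 21st Century*, CRC Press 2016,
  doi:10.1201/b19556, Thms. 14.1, 14.7, 14.8, 15.1, Prop. 15.1, proof of Thm. 15.5.
  [LemarieRieusset2016]
* H. Jia, V. Šverák, *Minimal L³-initial data for potential Navier–Stokes singularities*,
  SIAM J. Math. Anal. 45 (2013) 1448–1459 = arXiv:1201.1592, Lemma 2, Cor. 1, Lemma 8, proof of
  Thm. 1. [JiaSverak2013]
* G. Seregin, *Lecture Notes on Regularity Theory for the Navier–Stokes Equations*, World
  Scientific 2014, App. B, Prop. 1.8 and §B.5. [Seregin2014Notes]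
-/

noncomputable section

namespace Literature.Analysis.FluidPDE

/-- **Rusin–Šverák, Cor. 4.3, second clause, over the six undischarged leaves of its cone.**
The compactness modulo scalings and translations of the set of minimal blow-up data
(`rusin_sverak_minimal_data_compact`) follows from local existence (1) and extension (2) of local
energy solutions with `E²` data, the difference energy estimate behind weak–strong uniqueness (3),
Jia–Šverák's Lemma 2 (4) and Lemma 8 (5), and the limit step of the local Leray limiting
procedure (6); every other input of the printed proof — "the only reason for `T_max(u₀) < ∞` is
a singularity" (**N**, discharged), Kato's local theory, weak–strong uniqueness modulo (3),
ε-regularity, Prop. 2.2, Lemma 2.1, the Sobolev embedding `Ḣ^{1/2} ⊂ L³`, sequential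
Banach–Alaoglu and Radon–Riesz in `Ḣ^{1/2}` — is a theorem of the tree and is plugged in here or
in the reductions this term invokes. [cite: RusinSverak2011, Cor. 4.3 and its proof (arXiv:0911.0500 p. 8)] -/
theorem rusin_sverak_minimal_data_compact_of_six_leaves
    (h₁ : localEnergySolution_exists_local_of_memE2)
    (h₂ : localEnergySolution_extension_of_memE2)
    (h₃ : local_leray_difference_energy_estimate)
    (h₄ : jia_sverak_2013_lemma_2) (h₅ : jia_sverak_2013_lemma_8)
    (h₆ : localLeray_limit_isLocalLeraySolution) : rusin_sverak_minimal_data_compact :=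
  rusin_sverak_minimal_data_compact_of_singular_points' rusin_sverak_singular_point_of_blowup_holds
    (rusin_sverak_weak_limit_of_singular_points_of_six_leaves h₁ h₂ h₃ h₄ h₅ h₆)

/-- **Rusin–Šverák, Cor. 4.3, first clause (`rusin_sverak_minimal_blowup`: if some `Ḣ^{1/2}`
datum fails to have a global solution then so does one of minimal norm `ρ_max`), over the same
six leaves.** [cite: RusinSverak2011, Cor. 4.3 (arXiv:0911.0500 p. 8)] -/
theorem rusin_sverak_minimal_blowup_of_six_leaves
    (h₁ : localEnergySolution_exists_local_of_memE2)
    (h₂ : localEnergySolution_extension_of_memE2)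
    (h₃ : local_leray_difference_energy_estimate)
    (h₄ : jia_sverak_2013_lemma_2) (h₅ : jia_sverak_2013_lemma_8)
    (h₆ : localLeray_limit_isLocalLeraySolution) : rusin_sverak_minimal_blowup :=
  rusin_sverak_minimal_blowup_of_singular_points' rusin_sverak_singular_point_of_blowup_holds
    (rusin_sverak_weak_limit_of_singular_points_of_six_leaves h₁ h₂ h₃ h₄ h₅ h₆)

/-- **The weak-limit blow-up of the printed proof of Cor. 4.3 (sentences 2–4;
`rusin_sverak_weak_limit_blowup`), over the same six leaves.**
[cite: RusinSverak2011, proof of Cor. 4.3, sentences 2–4 (arXiv:0911.0500 p. 8), with Cor. 4.2 and §4 p. 6] -/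
theorem rusin_sverak_weak_limit_blowup_of_six_leaves
    (h₁ : localEnergySolution_exists_local_of_memE2)
    (h₂ : localEnergySolution_extension_of_memE2)
    (h₃ : local_leray_difference_energy_estimate)
    (h₄ : jia_sverak_2013_lemma_2) (h₅ : jia_sverak_2013_lemma_8)
    (h₆ : localLeray_limit_isLocalLeraySolution) : rusin_sverak_weak_limit_blowup :=
  rusin_sverak_weak_limit_blowup_of_singular_points' rusin_sverak_singular_point_of_blowup_holds
    (rusin_sverak_weak_limit_of_singular_points_of_six_leaves h₁ h₂ h₃ h₄ h₅ h₆)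

end Literature.Analysis.FluidPDE

end
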